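import Summits.Ventures.QEC.Census.BB.BB288.CoverLevel2Defs
import HarnessLib

set_option Elab.async false
set_option maxRecDepth 100000
set_option exponentiation.threshold 512

/-!
# `[[288,12,18]]` cover certificate — LEVEL 2 straggler lists (DATA for `CoverLevel2M2d`): per lane family, the codewords of
weight `≤ 16` it meets, ascending (computed by `work/cover288/gen_level2_v2.py`; every one is a `FOUND₂` word, which
`CoverLevel2M2d` re-checks by `Plane.subWalk`).  Statement-only data module; tier KERNEL.
-/

namespace Summit.Ventures.QEC.Census.BB288Cover

open Summit.Ventures.QEC.Census Literature.InformationTheory.QuantumCodes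

/-- Stragglers (codewords of weight `≤ 16`) of family `m2p12345` (301 lanes), ascending. -/
def m2p12345_allow : List ℕ := []

/-- Stragglers (codewords of weight `≤ 16`) of family `m2p012345` (25 lanes), ascending. -/
def m2p012345_allow : List ℕ := []


end Summit.Ventures.QEC.Census.BB288Cover
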